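import Mathlib

/-!
# FoolingMeasure — round-2, seat 1 (g7): first lemmas for three crux ideas

Crux `stmt-PneNP-19727` (`Summit.PneNP.PneNP.Theses.AeaCutRectangles.FoolingMeasure`, X1).
Crux workfiles are not importable, so the four base definitions (`Rulers`, `succ`, `IsNormal`,
`Aligned`) are copied VERBATIM from `Cruxes/FoolingMeasure/FrameTwoColourings.lean` (seat 1 g6),
which copied them from seat 2's `NormalCycleSystems.lean`.

* Card A `shadow-extension-count`: `residue_foreign`, `residue_own` (drop-ruler colourability core),
  `shadow`, `extCount`, `normalCount_succ_eq_sum_ext` (the shadow decomposition, proved),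
  `shadow_properly_coloured` (every shadow of a normal system is 3-coloured by the dropped ruler's
  residue, proved), conjecture `NormalAbundanceExp`.
* Card B `orientation-rigidity`: `shared_step_same_order` (proved), `shared_own_foreign_inverted` (proved).
* Card C `clique-moment-hierarchy`: `clique_mass_pow_le` (proved, abstract tensor-power inequality).

Restricted-model rung (AEA cut rectangles vs NON-3-COL); P ≠ NP is not moved by anything here.
-/

set_option linter.dupNamespace false

namespace Summit.PneNP.PneNP.Cruxes.FoolingMeasure.IdeasR2g7

open Finset

/-- `t` rulers on `n = 3q+1` vertices: `P k v` is the position of vertex `v` along ruler `k`. (copied) -/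
abbrev Rulers (q t : ℕ) := Fin t → Equiv.Perm (Fin (3 * q + 1))

variable {q t : ℕ}

/-- successor of `v` along ruler `k`. (copied) -/
def succ (P : Rulers q t) (k : Fin t) (v : Fin (3 * q + 1)) : Fin (3 * q + 1) :=
  (P k).symm (P k v + 1)

/-- NORMALITY: every edge of cycle `k`, read along any other ruler `i`, jumps forward by `≡ 2 (mod 3)`. (copied) -/
def IsNormal (P : Rulers q t) : Prop :=
  ∀ i k : Fin t, i ≠ k → ∀ v, ((P i (succ P k v) - P i v).val) % 3 = 2

/-- residue alignment of two systems on `B` (all rulers). (copied) -/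
def Aligned (P P' : Rulers q t) (B : Finset (Fin (3 * q + 1))) : Prop :=
  ∀ k, ∀ v ∈ B, (P k v).val % 3 = (P' k v).val % 3

/-- `Fin` subtraction, both cases (re-proved; same statement as seat 1 g6). -/
theorem val_sub_cases {n : ℕ} [NeZero n] (a b : Fin n) :
    (((a - b : Fin n) : ℕ) = a.val - b.val ∧ b.val ≤ a.val) ∨
    (((a - b : Fin n) : ℕ) = n + a.val - b.val ∧ a.val < b.val) := by
  have h := congrArg Fin.val (sub_add_cancel a b)
  rw [Fin.val_add_eq_ite] at h
  have h1 := (a - b).isLt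
  have h2 := b.isLt
  split_ifs at h with hle <;> omega

/-! ## Card A — drop-ruler colourability and the shadow decomposition -/

/-- The residue `pos_i mod 3` of ANY ruler `i` properly colours every edge of every OTHER cycle `k ≠ i`
(normality, read in both cyclic directions since `n ≡ 1 (mod 3)`). -/
theorem residue_foreign (P : Rulers q t) (hP : IsNormal P) {i k : Fin t} (hik : i ≠ k)
    (v : Fin (3 * q + 1)) : (P i v).val % 3 ≠ (P i (succ P k v)).val % 3 := by
  have h := hP i k hik v
  rcases val_sub_cases (P i (succ P k v)) (P i v) with ⟨h1, h2⟩ | ⟨h1, h2⟩ <;> omega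

/-- … and it properly colours every NON-WRAP edge of its own cycle (positions `p → p+1`, `p ≠ 3q`).
So `pos_i mod 3` is a proper 3-colouring of `G(P)` minus the single wrap edge of ruler `i`
(seat 2's `normal_erase_colorable`, residue form); the new use is the SHADOW below. -/
theorem residue_own (hq : 0 < q) (P : Rulers q t) (k : Fin t) (v : Fin (3 * q + 1))
    (hv : (P k v).val ≠ 3 * q) : (P k v).val % 3 ≠ (P k (succ P k v)).val % 3 := by
  have h1 : P k (succ P k v) = P k v + 1 := by simp [succ]
  have h3 : (1 : ℕ) % (3 * q + 1) = 1 := Nat.mod_eq_of_lt (by omega)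
  have h2 : (P k v + 1).val = (P k v).val + 1 := by
    rw [Fin.val_add, Fin.val_one', h3, Nat.mod_eq_of_lt (by have := (P k v).isLt; omega)]
  rw [h1, h2]; omega

/-- the SHADOW of a `(t+1)`-system: forget the last ruler. -/
def shadow (P : Rulers q (t + 1)) : Rulers q t := fun k => P k.castSucc

theorem succ_shadow (P : Rulers q (t + 1)) (k : Fin t) (v : Fin (3 * q + 1)) :
    succ (shadow P) k v = succ P k.castSucc v := rfl

/-- Every shadow of a NORMAL `(t+1)`-system is properly 3-coloured by the residue of the dropped
ruler: the only normal systems that EXTEND are 3-colourable ones (with a balanced colouring). -/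
theorem shadow_properly_coloured (P : Rulers q (t + 1)) (hP : IsNormal P) (k : Fin t)
    (v : Fin (3 * q + 1)) :
    (P (Fin.last t) v).val % 3 ≠ (P (Fin.last t) (succ (shadow P) k v)).val % 3 := by
  rw [succ_shadow]
  exact residue_foreign P hP (Fin.ne_of_gt k.castSucc_lt_last) v

open Classical in
/-- number of normal `t`-systems on `3q+1` labelled vertices (labelled count, as seat 2's `normalCount`). -/
noncomputable def normalCount' (q t : ℕ) : ℕ := #{P : Rulers q t | IsNormal P}

open Classical in
/-- number of NORMAL one-ruler extensions of a `t`-system `S` (zero unless `S` is normal and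
3-colourable by a balanced colouring, by `shadow_properly_coloured`). -/
noncomputable def extCount (S : Rulers q t) : ℕ :=
  #{P ∈ ({P : Rulers q (t + 1) | IsNormal P} : Finset (Rulers q (t + 1))) | shadow P = S}

open Classical in
/-- SHADOW DECOMPOSITION: normal `(t+1)`-systems are counted through their shadows. -/
theorem normalCount_succ_eq_sum_ext (q t : ℕ) :
    normalCount' q (t + 1) = ∑ S : Rulers q t, extCount S := by
  unfold normalCount' extCount
  exact Finset.card_eq_sum_card_fiberwise (fun P _ => Finset.mem_coe.mpr (Finset.mem_univ (shadow P)))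

/-- Conjecture K_A (card A): abundance with EXPONENTIAL accuracy — the strength the one-sided
free-model transfer actually needs (seat 2's `NormalAbundance` with `(n!)^{t-1-ε}` is weaker by a
factor `≈ n!·3^{t(t-1)n}`; `StrongAbundanceIHD` of seat 2 g5 is the in-support version). -/
def NormalAbundanceExp (t : ℕ) : Prop :=
  ∃ K : ℝ, ∀ᶠ q : ℕ in Filter.atTop,
    ((Nat.factorial (3 * q + 1) : ℝ)) ^ t * (3 : ℝ) ^ (-((t * (t - 1) * (3 * q + 1) : ℕ) : ℝ))
        * (2 : ℝ) ^ (-(K * (3 * q + 1 : ℝ))) ≤ (normalCount' q t : ℝ)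

/-! ## Card B — orientation rigidity of shared steps under alignment + normality -/

/-- ORIENTATION RIGIDITY.  Two normal systems aligned on `B`; a pair `{u,w} ⊆ B` which is a step of a
cycle foreign to ruler `k` in BOTH systems (in either direction, possibly of different cycles) has the
SAME `k`-order in both systems.  Consequence (card B): in an aligned family every certificate of
blocking / seam-covering between two members lives on order DISAGREEMENTS, hence on structure that is
NOT common to the members; planted ("pinned") common structure certifies nothing. -/
theorem shared_step_same_order (P P' : Rulers q t) (hP : IsNormal P) (hP' : IsNormal P')
    {B : Finset (Fin (3 * q + 1))} (hal : Aligned P P' B) {k j j' : Fin t} (hkj : k ≠ j)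
    (hkj' : k ≠ j') {u w : Fin (3 * q + 1)} (huw : u ≠ w) (hu : u ∈ B) (hw : w ∈ B)
    (hs : succ P j u = w ∨ succ P j w = u) (hs' : succ P' j' u = w ∨ succ P' j' w = u) :
    ((P k u).val < (P k w).val ↔ (P' k u).val < (P' k w).val) := by
  have au := hal k u hu
  have aw := hal k w hw
  have hne : (P k u).val ≠ (P k w).val := fun e => huw ((P k).injective (Fin.ext e))
  have hne' : (P' k u).val ≠ (P' k w).val := fun e => huw ((P' k).injective (Fin.ext e))
  have nP : ((P k w - P k u).val % 3 = 2) ∨ ((P k u - P k w).val % 3 = 2) := by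
    rcases hs with h | h
    · left; have := hP k j hkj u; rwa [h] at this
    · right; have := hP k j hkj w; rwa [h] at this
  have nP' : ((P' k w - P' k u).val % 3 = 2) ∨ ((P' k u - P' k w).val % 3 = 2) := by
    rcases hs' with h | h
    · left; have := hP' k j' hkj' u; rwa [h] at this
    · right; have := hP' k j' hkj' w; rwa [h] at this
  have lu := (P k u).isLt; have lw := (P k w).isLt; have lu' := (P' k u).isLt; have lw' := (P' k w).isLt
  rcases val_sub_cases (P k w) (P k u) with ⟨a1, a2⟩ | ⟨a1, a2⟩ <;>
  rcases val_sub_cases (P k u) (P k w) with ⟨b1, b2⟩ | ⟨b1, b2⟩ <;>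
  rcases val_sub_cases (P' k w) (P' k u) with ⟨c1, c2⟩ | ⟨c1, c2⟩ <;>
  rcases val_sub_cases (P' k u) (P' k w) with ⟨d1, d2⟩ | ⟨d1, d2⟩ <;>
  rcases nP with nP | nP <;> rcases nP' with nP' | nP' <;> (constructor <;> intro <;> omega)

/-- MIXED TYPE FORCES INVERSION.  If `{u,w} ⊆ B` is a non-wrap step `u → w` of ruler `k` itself in
`P` and a step of a cycle foreign to `k` in the aligned system `P'`, then `w` is `k`-EARLIER than `u`
in `P'` (the pair is inverted).  So an inside `k`-seam of `P` can be an edge of `P'` only as an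
inverted foreign chord. -/
theorem shared_own_foreign_inverted (hq : 0 < q) (P P' : Rulers q t) (hP' : IsNormal P')
    {B : Finset (Fin (3 * q + 1))} (hal : Aligned P P' B) {k j' : Fin t} (hkj' : k ≠ j')
    {u w : Fin (3 * q + 1)} (hu : u ∈ B) (hw : w ∈ B) (hs : succ P k u = w)
    (hv : (P k u).val ≠ 3 * q) (hs' : succ P' j' u = w ∨ succ P' j' w = u) :
    (P' k w).val < (P' k u).val := by
  have au := hal k u hu
  have aw := hal k w hw
  have h1 : P k w = P k u + 1 := by rw [← hs]; simp [succ]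
  have h3 : (1 : ℕ) % (3 * q + 1) = 1 := Nat.mod_eq_of_lt (by omega)
  have h2 : (P k w).val = (P k u).val + 1 := by
    rw [h1, Fin.val_add, Fin.val_one', h3, Nat.mod_eq_of_lt (by have := (P k u).isLt; omega)]
  have huw : u ≠ w := by
    intro e; subst e; omega
  have hne' : (P' k u).val ≠ (P' k w).val := fun e => huw ((P' k).injective (Fin.ext e))
  have nP' : ((P' k w - P' k u).val % 3 = 2) ∨ ((P' k u - P' k w).val % 3 = 2) := by
    rcases hs' with h | h
    · left; have := hP' k j' hkj' u; rwa [h] at this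
    · right; have := hP' k j' hkj' w; rwa [h] at this
  have lu' := (P' k u).isLt; have lw' := (P' k w).isLt
  rcases val_sub_cases (P' k w) (P' k u) with ⟨c1, c2⟩ | ⟨c1, c2⟩ <;>
  rcases val_sub_cases (P' k u) (P' k w) with ⟨d1, d2⟩ | ⟨d1, d2⟩ <;>
  rcases nP' with nP' | nP' <;> omega

/-! ## Card C — the clique-moment hierarchy (tensor-power trick), abstract form -/

/-- For a reflexive-on-`F` relation `Rel` (think: "the two systems are mutually blocked, or equal")
and nonnegative weights, the mass of a clique `F` satisfies `μ(F)^{k+1} ≤ q_k`, where `q_k` is the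
total `μ^{⊗(k+1)}`-weight of `(k+1)`-tuples that are pairwise related.  With `Rel` = two-blocked-or-
equal and `F` = the member set of a valid rectangle this is `μ(R)^{k+1} ≤ q_k(μ)`; `k = 1` is
`SwapBookends.rect_sum_le_of_pSwap_le_sq`. -/
theorem clique_mass_pow_le {α : Type*} [Fintype α] [DecidableEq α] (μ : α → ℝ)
    (hμ : ∀ x, 0 ≤ μ x) (Rel : α → α → Prop) [DecidableRel Rel] (F : Finset α)
    (hF : ∀ x ∈ F, ∀ y ∈ F, Rel x y) (k : ℕ) :
    (∑ x ∈ F, μ x) ^ (k + 1) ≤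
      ∑ p ∈ (Fintype.piFinset fun _ : Fin (k + 1) => (Finset.univ : Finset α)).filter
          (fun p => ∀ i j, Rel (p i) (p j)), ∏ i, μ (p i) := by
  have h0 : (∑ x ∈ F, μ x) ^ (k + 1) = ∏ _i : Fin (k + 1), ∑ x ∈ F, μ x := by
    simp [Finset.prod_const]
  have h1 : (∑ x ∈ F, μ x) ^ (k + 1) =
      ∑ p ∈ Fintype.piFinset (fun _ : Fin (k + 1) => F), ∏ i, μ (p i) := by
    rw [h0, Finset.prod_univ_sum]
  rw [h1]
  apply Finset.sum_le_sum_of_subset_of_nonneg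
  · intro p hp
    have hp' := Fintype.mem_piFinset.mp hp
    exact Finset.mem_filter.mpr
      ⟨Fintype.mem_piFinset.mpr fun _ => Finset.mem_univ _, fun i j => hF _ (hp' i) _ (hp' j)⟩
  · intro p _ _
    exact Finset.prod_nonneg fun i _ => hμ _

end Summit.PneNP.PneNP.Cruxes.FoolingMeasure.IdeasR2g7
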